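import Literature.NumberTheory.Transcendental.KZCubicalCalculus
import Mathlib.Analysis.SpecialFunctions.Trigonometric.Arctan
import Mathlib.Algebra.Polynomial.Derivative
import Mathlib.RingTheory.Algebraic.Integral

/-!
# `StokesGeneration` (stmt-KontsevichZagierPeriods-3586) — line `fibrewise_stokes`, stub `stub_rungLeftoverLoop`

Rung 4 of the line (full angular sector of the residual S2, root-free). After cutting a polynomial loop into
pieces, the boundary leftover is `γ Σₖ τₖ/(1 + τₖ² y²) = γ·Im(Q′/Q)` for the loop `Q(y) = Πₖ (1 + iτₖ y)`.
This file provides `Q`'s real and imaginary parts as honest REAL polynomials `(AQ, BQ)` with algebraic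
coefficients (for algebraic `τₖ`), defined recursively by `AQ₀ = 1`, `BQ₀ = 0`,
`AQₖ₊₁ = AQₖ − τₖ X·BQₖ`, `BQₖ₊₁ = BQₖ + τₖ X·AQₖ` (multiplication by `1 + iτₖ X`), together with

* the polar form `AQ(y) = |Q(y)| cos S(y)`, `BQ(y) = |Q(y)| sin S(y)` with `|Q(y)| = Πₖ √(1 + τₖ² y²)` and
  `S(y) = Σₖ arctan(τₖ y)` (addition theorems and `cos(arctan x) = 1/√(1+x²)`, `sin(arctan x) = x/√(1+x²)`),
* `AQ² + BQ² = Πₖ (1 + τₖ² y²)`,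
* the logarithmic-derivative identity `AQ·BQ′ − AQ′·BQ = (Πₖ (1 + τₖ² y²))·Σₖ τₖ/(1 + τₖ² y²)`
  (inductively `A₊B₊′ − A₊′B₊ = (1 + τ²y²)(AB′ − A′B) + τ(A² + B²)`).

Everything is proved by induction on the number of factors; no complex numbers are used. [folklore]
-/

noncomputable section

-- `Summit.KontsevichZagierPeriods.KontsevichZagierPeriods.…` is the tree's mandated layout (single-conjunct summit).
set_option linter.dupNamespace false

namespace Summit.KontsevichZagierPeriods.KontsevichZagierPeriods.Cruxes.StokesGeneration.FibrewiseStokes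

open MeasureTheory Set
open Literature.NumberTheory.Transcendental
open Literature.NumberTheory.Transcendental.KZ
open Literature.ModelTheory.ExponentialFields (IsSemialgebraic)

/-- Multiplying a real polynomial with `ℚ`-algebraic coefficients by `X` keeps all coefficients
`ℚ`-algebraic (the coefficients are shifted by one, the constant coefficient becomes `0`). [folklore] -/
private theorem rungLeftoverLoop_coeff_X_mul {p : Polynomial ℝ} (hp : ∀ m, IsAlgebraic ℚ (p.coeff m)) :
    ∀ m, IsAlgebraic ℚ ((Polynomial.X * p).coeff m)
  | 0 => by rw [Polynomial.coeff_X_mul_zero]; exact isAlgebraic_zero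
  | m + 1 => by rw [Polynomial.coeff_X_mul]; exact hp m

/-- The coefficients of `C c * X * p` are `ℚ`-algebraic when `c` and all coefficients of `p` are. [folklore] -/
private theorem rungLeftoverLoop_coeff_C_mul_X_mul {c : ℝ} (hc : IsAlgebraic ℚ c) {p : Polynomial ℝ}
    (hp : ∀ m, IsAlgebraic ℚ (p.coeff m)) (m : ℕ) :
    IsAlgebraic ℚ ((Polynomial.C c * Polynomial.X * p).coeff m) := by
  rw [mul_assoc, Polynomial.coeff_C_mul]
  exact hc.mul (rungLeftoverLoop_coeff_X_mul hp m)

/-- Evaluation of the recursion step `p ∓ C c * X * q` at a point: `(C c * X * q)(y) = c * y * q(y)`.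
[folklore] -/
private theorem rungLeftoverLoop_eval_C_mul_X_mul (c y : ℝ) (q : Polynomial ℝ) :
    (Polynomial.C c * Polynomial.X * q).eval y = c * y * q.eval y := by
  rw [Polynomial.eval_mul, Polynomial.eval_mul, Polynomial.eval_C, Polynomial.eval_X]

/-- Evaluation of the derivative of `C c * X * q` at a point: `(C c * X * q)′(y) = c * q(y) + c * y * q′(y)`.
[folklore] -/
private theorem rungLeftoverLoop_eval_derivative_C_mul_X_mul (c y : ℝ) (q : Polynomial ℝ) :
    (Polynomial.derivative (Polynomial.C c * Polynomial.X * q)).eval y =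
      c * q.eval y + c * y * (Polynomial.derivative q).eval y := by
  rw [Polynomial.derivative_mul, Polynomial.derivative_C_mul_X, Polynomial.eval_add, Polynomial.eval_mul,
    Polynomial.eval_C, rungLeftoverLoop_eval_C_mul_X_mul]

/-- **Registered stub `stub_rungLeftoverLoop` (R12).** The leftover loop `Q(y) = Π_{k<n} (1 + i τₖ y)` as a
pair of REAL polynomials `(AQ, BQ)` (recursively `AQ₀ = 1`, `BQ₀ = 0`, `AQ_{k+1} = AQₖ − τₖ X·BQₖ`,
`BQ_{k+1} = BQₖ + τₖ X·AQₖ`): algebraic coefficients for algebraic `τₖ`, polar form `AQ = |Q| cos S`,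
`BQ = |Q| sin S` with `|Q| = Πₖ √(1 + τₖ² y²)`, `S(y) = Σₖ arctan(τₖ y)` (addition theorems with
`cos(arctan x) = 1/√(1+x²)`, `sin(arctan x) = x/√(1+x²)`), `AQ² + BQ² = Πₖ (1 + τₖ² y²)`, and the logarithmic
derivative `AQ·BQ′ − AQ′·BQ = (Πₖ (1 + τₖ² y²))·Σₖ τₖ/(1 + τₖ² y²)` (induction:
`A₊B₊′ − A₊′B₊ = (1 + τ²y²)(AB′ − A′B) + τ(A² + B²)`). [folklore] -/
theorem stub_rungLeftoverLoop :
    ∀ (n : ℕ) (τ : ℕ → ℝ), (∀ k, k < n → IsAlgebraic ℚ (τ k)) →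
      ∃ (AQ BQ : Polynomial ℝ), (∀ m, IsAlgebraic ℚ (AQ.coeff m)) ∧ (∀ m, IsAlgebraic ℚ (BQ.coeff m)) ∧
        (∀ y : ℝ, AQ.eval y = (∏ k ∈ Finset.range n, Real.sqrt (1 + (τ k * y) ^ 2)) *
          Real.cos (∑ k ∈ Finset.range n, Real.arctan (τ k * y))) ∧
        (∀ y : ℝ, BQ.eval y = (∏ k ∈ Finset.range n, Real.sqrt (1 + (τ k * y) ^ 2)) *
          Real.sin (∑ k ∈ Finset.range n, Real.arctan (τ k * y))) ∧
        (∀ y : ℝ, AQ.eval y ^ 2 + BQ.eval y ^ 2 = ∏ k ∈ Finset.range n, (1 + (τ k * y) ^ 2)) ∧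
        (∀ y : ℝ, AQ.eval y * (Polynomial.derivative BQ).eval y - (Polynomial.derivative AQ).eval y * BQ.eval y =
          (∏ k ∈ Finset.range n, (1 + (τ k * y) ^ 2)) * ∑ k ∈ Finset.range n, τ k / (1 + (τ k * y) ^ 2)) := by
  intro n τ hτ
  induction n with
  | zero =>
    refine ⟨1, 0, fun m => ?_, fun m => ?_, fun y => ?_, fun y => ?_, fun y => ?_, fun y => ?_⟩
    · rw [Polynomial.coeff_one]
      split_ifs
      · exact isAlgebraic_one
      · exact isAlgebraic_zero
    · rw [Polynomial.coeff_zero]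
      exact isAlgebraic_zero
    · simp
    · simp
    · simp
    · simp
  | succ n ih =>
    obtain ⟨A, B, hA, hB, h1, h2, h3, h4⟩ := ih (fun k hk => hτ k (Nat.lt_succ_of_lt hk))
    have hτn : IsAlgebraic ℚ (τ n) := hτ n (Nat.lt_succ_self n)
    -- evaluations of the new pair and of its derivatives
    have eA : ∀ y : ℝ, (A - Polynomial.C (τ n) * Polynomial.X * B).eval y =
        A.eval y - τ n * y * B.eval y := fun y => by
      rw [Polynomial.eval_sub, rungLeftoverLoop_eval_C_mul_X_mul]
    have eB : ∀ y : ℝ, (B + Polynomial.C (τ n) * Polynomial.X * A).eval y =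
        B.eval y + τ n * y * A.eval y := fun y => by
      rw [Polynomial.eval_add, rungLeftoverLoop_eval_C_mul_X_mul]
    have eA' : ∀ y : ℝ, (Polynomial.derivative (A - Polynomial.C (τ n) * Polynomial.X * B)).eval y =
        (Polynomial.derivative A).eval y - (τ n * B.eval y + τ n * y * (Polynomial.derivative B).eval y) :=
      fun y => by
      rw [Polynomial.derivative_sub, Polynomial.eval_sub, rungLeftoverLoop_eval_derivative_C_mul_X_mul]
    have eB' : ∀ y : ℝ, (Polynomial.derivative (B + Polynomial.C (τ n) * Polynomial.X * A)).eval y =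
        (Polynomial.derivative B).eval y + (τ n * A.eval y + τ n * y * (Polynomial.derivative A).eval y) :=
      fun y => by
      rw [Polynomial.derivative_add, Polynomial.eval_add, rungLeftoverLoop_eval_derivative_C_mul_X_mul]
    refine ⟨A - Polynomial.C (τ n) * Polynomial.X * B, B + Polynomial.C (τ n) * Polynomial.X * A,
      fun m => ?_, fun m => ?_, fun y => ?_, fun y => ?_, fun y => ?_, fun y => ?_⟩
    · -- coefficients of `A - C τₙ X B`
      rw [Polynomial.coeff_sub]
      exact (hA m).sub (rungLeftoverLoop_coeff_C_mul_X_mul hτn hB m)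
    · -- coefficients of `B + C τₙ X A`
      rw [Polynomial.coeff_add]
      exact (hB m).add (rungLeftoverLoop_coeff_C_mul_X_mul hτn hA m)
    · -- polar form, real part
      have hs : Real.sqrt (1 + (τ n * y) ^ 2) ≠ 0 := (Real.sqrt_pos.2 (by positivity)).ne'
      rw [eA, h1 y, h2 y, Finset.prod_range_succ, Finset.sum_range_succ, Real.cos_add, Real.cos_arctan,
        Real.sin_arctan]
      set R := ∏ k ∈ Finset.range n, Real.sqrt (1 + (τ k * y) ^ 2)
      set S := ∑ k ∈ Finset.range n, Real.arctan (τ k * y)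
      linear_combination (-(R * Real.cos S) + τ n * y * (R * Real.sin S)) * mul_inv_cancel₀ hs
    · -- polar form, imaginary part
      have hs : Real.sqrt (1 + (τ n * y) ^ 2) ≠ 0 := (Real.sqrt_pos.2 (by positivity)).ne'
      rw [eB, h1 y, h2 y, Finset.prod_range_succ, Finset.sum_range_succ, Real.sin_add, Real.cos_arctan,
        Real.sin_arctan]
      set R := ∏ k ∈ Finset.range n, Real.sqrt (1 + (τ k * y) ^ 2)
      set S := ∑ k ∈ Finset.range n, Real.arctan (τ k * y)
      linear_combination (-(R * Real.sin S + τ n * y * (R * Real.cos S))) * mul_inv_cancel₀ hs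
    · -- sum of squares
      rw [eA, eB, Finset.prod_range_succ, ← h3 y]
      ring
    · -- logarithmic derivative
      have hne : (1 + (τ n * y) ^ 2) ≠ 0 := by positivity
      have key : (A - Polynomial.C (τ n) * Polynomial.X * B).eval y *
            (Polynomial.derivative (B + Polynomial.C (τ n) * Polynomial.X * A)).eval y -
          (Polynomial.derivative (A - Polynomial.C (τ n) * Polynomial.X * B)).eval y *
            (B + Polynomial.C (τ n) * Polynomial.X * A).eval y =
          (1 + (τ n * y) ^ 2) * (A.eval y * (Polynomial.derivative B).eval y -
            (Polynomial.derivative A).eval y * B.eval y) + τ n * (A.eval y ^ 2 + B.eval y ^ 2) := by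
        rw [eA, eB, eA', eB']
        ring
      rw [key, h4 y, h3 y, Finset.prod_range_succ, Finset.sum_range_succ]
      set P := ∏ k ∈ Finset.range n, (1 + (τ k * y) ^ 2)
      linear_combination (-(τ n * P)) * mul_inv_cancel₀ hne

end Summit.KontsevichZagierPeriods.KontsevichZagierPeriods.Cruxes.StokesGeneration.FibrewiseStokes

end
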